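import Summits.PneNP.PneNP.Theorems.SymmetryBudgetNoHiddenOrderGraphReadout
import Summits.PneNP.PneNP.Theorems.SymmetryBudgetNoHiddenOrderBitValuationDefs
import Summits.PneNP.PneNP.Theorems.SymmetryBudgetNoHiddenOrderReplayRootDefs

/-!
# `NoHiddenOrder` (stmt-PneNP-14781), (R2c) function level: signature ranks and the BIT READOUT of the root value

Route `PneNP/SymmetryBudget`; continues `SymmetryBudgetNoHiddenOrderGraphReadout.lean` (readout `outM` of row colours / row bits of an
UNKNOWN enumeration of the window).  Two function-level facts the symmetric compilation of the certified-label scheme needs at its two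
ends, in the exact vocabulary of the compiler:

* **Signature ranks** (the INITIAL COLOURING of the window `W`).  `keyRank S f a = #{b ∈ S | f b < f a}` (competition rank of a key; the
  form of `SymProg.VecCmp.rankIn`): ranks are `< |S|` and equal ranks inside `S` mean equal keys.  For the symmetrised outside signature
  `osig` and for the RAW signature `rawSig` (the semantics of the signature wires `sigWire` of `…ReplayRootDefs.lean`) this gives the readout
  hypothesis `hsig` of `GraphReadout.outM_sound` — equal colour ⇒ equal adjacency to every ordered vertex — for the rank colouring and for
  every colouring refining it on `W` (e.g. `BranchSum.refineIn … W …`, by `refineIn_refines`).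
* **The bit readout.**  The root group of the scheme outputs a bitvector `E : CGBits.BVal n` which is the encoding `bitEnc` of the window read
  along an enumeration unknown to the circuit (`CGBits.root_value_bitEnc`).  `outB W G colw hn E` is the output MATRIX formed from the bits of
  `E`, the colour tests `[colw u = c]` and the input adjacency alone — window × window: the adjacency bit at the two ranks; window × ordered:
  "for some colour `c`, row `rank u` has colour bit `c` and some window vertex of colour `c` is adjacent to the ordered vertex" (an OR of ANDs);
  ordered × ordered: the input.  `RowData` says abstractly what `E` must satisfy (rows `l k ∈ W`, distinct, colour bits = `[colw (l k) = c]`,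
  adjacency bits = adjacency of the rows); then `outB = outM` entrywise (`outB_eq_outM`) and **`outB_sound`** / **`outB_sound_matrix`**: the graph
  of `outB` is the graph of a relabelling of the input by a permutation fixing the ordered part (in `Bud(m,⌊log₂ m⌋)` for `W = windowSet m`) —
  the `sound` field of `GraphProgram` as soon as the output wires read `outB`.  `RowData` is discharged for both shapes of the root theorem:
  the process on `Fin m` with start block `W` (`rowData_of_isEnum`) and the process on the window TYPE `↥W` with the induced graph
  `G.comap Subtype.val` (`rowData_of_isEnum_subtype`).
Sorry-free; supports stmt-PneNP-14781, does not close it.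
-/

set_option linter.dupNamespace false -- `Summit.PneNP.PneNP.…` (D-0017 single-conjunct layout)

namespace Summit.PneNP.PneNP.Theorems

open Finset CGBits Literature.Computability.Complexity Literature.Computability.Complexity.SymProg
open Summit.PneNP.PneNP.Theses.SymmetryBudget

namespace GraphReadout

/-! ### Competition ranks of a key -/

section KeyRank

variable {α β : Type*} [LinearOrder β] (S : Finset α) (f : α → β)

/-- The COMPETITION RANK of the key of `a` inside `S`: the number of members with a strictly smaller key. [folklore] -/
def keyRank (a : α) : ℕ := (S.filter fun b => f b < f a).card

variable {S f}

/-- A member's rank is below `|S|`. [folklore] -/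
theorem keyRank_lt_card {a : α} (ha : a ∈ S) : keyRank S f a < S.card :=
  card_lt_card ((filter_ssubset).2 ⟨a, ha, lt_irrefl _⟩)

/-- A strictly smaller key has a strictly smaller rank (for a member). [folklore] -/
theorem keyRank_lt_keyRank {a b : α} (ha : a ∈ S) (h : f a < f b) : keyRank S f a < keyRank S f b := by
  refine card_lt_card ((ssubset_iff_of_subset fun c hc => ?_).2 ⟨a, mem_filter.2 ⟨ha, h⟩, fun h' => lt_irrefl _ (mem_filter.1 h').2⟩)
  exact mem_filter.2 ⟨(mem_filter.1 hc).1, (mem_filter.1 hc).2.trans h⟩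

/-- **Equal ranks inside `S` mean equal keys.** [folklore] -/
theorem key_eq_of_keyRank_eq {a b : α} (ha : a ∈ S) (hb : b ∈ S) (h : keyRank S f a = keyRank S f b) : f a = f b := by
  rcases lt_trichotomy (f a) (f b) with h' | h' | h'
  · exact absurd h (keyRank_lt_keyRank ha h').ne
  · exact h'
  · exact absurd h (keyRank_lt_keyRank hb h').ne'

end KeyRank

/-! ### The symmetrised outside signature and its rank -/

section Sig

variable {m : ℕ} (W : Finset (Fin m)) (G : SimpleGraph (Fin m)) [DecidableRel G.Adj]

/-- The OUTSIDE SIGNATURE of `u`: its adjacency towards the ordered indices (window positions blanked). [folklore] -/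
def osig (u : Fin m) : Fin m → Bool := fun i => decide (i ∉ W ∧ G.Adj i u)

/-- The SIGNATURE RANK of `u` inside the window: competition rank of the signature in the lexicographic order. [folklore] -/
noncomputable def sigRank (u : Fin m) : ℕ := keyRank W (fun v => toLex (osig W G v)) u

variable {W G}

/-- Signature ranks of window vertices are `< |W|` (so they are colours the bit valuation can hold). [folklore] -/
theorem sigRank_lt_card {u : Fin m} (hu : u ∈ W) : sigRank W G u < W.card := keyRank_lt_card hu

/-- **Equal signature rank ⇒ equal adjacency to every ordered vertex** (the readout hypothesis `hsig` for the rank colouring). [folklore] -/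
theorem adj_iff_of_sigRank_eq {u v : Fin m} (hu : u ∈ W) (hv : v ∈ W) (h : sigRank W G u = sigRank W G v) (i : Fin m) (hi : i ∉ W) :
    G.Adj i u ↔ G.Adj i v := by
  have hk : osig W G u = osig W G v := toLex.injective (key_eq_of_keyRank_eq (f := fun v => toLex (osig W G v)) hu hv h)
  have := congrFun hk i
  simp only [osig, hi, not_false_eq_true, true_and, decide_eq_decide] at this
  exact this

/-- The readout hypothesis for ANY colouring refining the signature ranks on `W` (e.g. `refineIn G W (sigRank W G)`). [folklore] -/
theorem hsig_of_refines_sigRank {col : Fin m → ℕ} (hcol : ∀ u ∈ W, ∀ v ∈ W, col u = col v → sigRank W G u = sigRank W G v) :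
    ∀ u ∈ W, ∀ v ∈ W, col u = col v → ∀ i, i ∉ W → (G.Adj i u ↔ G.Adj i v) :=
  fun _ hu _ hv h i hi => adj_iff_of_sigRank_eq hu hv (hcol _ hu _ hv h) i hi

/-- In particular for the refinement `refineIn G W (sigRank W G)` of the rank colouring inside the window. [folklore] -/
theorem hsig_refineIn_sigRank :
    ∀ u ∈ W, ∀ v ∈ W, BranchSum.refineIn G W (sigRank W G) u = BranchSum.refineIn G W (sigRank W G) v →
      ∀ i, i ∉ W → (G.Adj i u ↔ G.Adj i v) :=
  hsig_of_refines_sigRank fun _ hu _ hv h => BranchSum.refineIn_refines _ hu hv h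

end Sig

/-! ### The raw signature (semantics of the signature wires `sigWire`) -/

section RawSig

variable {m : ℕ} (W : Finset (Fin m)) (x : Fin m × Fin m → Bool)

/-- The RAW SIGNATURE of `u`: position `j < m` is the row entry `x (u, j)`, position `m + j` the column entry `x (j, u)`, window
positions blanked — the values of the wires `sigWire W ff u ·`. [folklore] -/
def rawSig (u : Fin m) (j : Fin (m + m)) : Bool :=
  if h : (j : ℕ) < m then (if (⟨j, h⟩ : Fin m) ∈ W then false else x (u, ⟨j, h⟩))
  else (if (⟨j - m, by omega⟩ : Fin m) ∈ W then false else x (⟨j - m, by omega⟩, u))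

variable {W x}

/-- **The signature wires read the raw signature**: whatever wire values `v` with `v ff = false`. [folklore] -/
theorem wval_sigWire {Λ : Type*} (v : Λ → Bool) {ff : Λ} (hff : v ff = false) (u : Fin m) (j : Fin (m + m)) :
    wval x v (sigWire W (Sum.inr ff) u j) = rawSig W x u j := by
  unfold sigWire rawSig
  split_ifs <;> simp [hff]

/-- For a `VecCmp` gadget whose vectors are the signature wires, the compared vectors ARE the raw signatures. [folklore] -/
theorem vecCmp_B_eq_rawSig {Λ : Type*} [DecidableEq Λ] {P : SymProg (Fin m × Fin m) Λ} (C : P.VecCmp (Fin m) (m + m)) {ff : Λ}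
    (hff : P.sem x ff = false) (hb : ∀ u j, C.b u j = sigWire W (Sum.inr ff) u j) (u : Fin m) : C.B x u = rawSig W x u := by
  funext j
  show wval x (P.sem x) (C.b u j) = _
  rw [hb, wval_sigWire _ hff]

/-- **Equal raw signature ⇒ equal adjacency to every ordered vertex** in the graph `rootGraph x` of the matrix. [folklore] -/
theorem rootGraph_adj_iff_of_rawSig_eq {u v : Fin m} (hu : u ∈ W) (hv : v ∈ W) (h : rawSig W x u = rawSig W x v) (i : Fin m)
    (hi : i ∉ W) : (rootGraph x).Adj i u ↔ (rootGraph x).Adj i v := by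
  have hiu : i ≠ u := fun h' => hi (h' ▸ hu)
  have hiv : i ≠ v := fun h' => hi (h' ▸ hv)
  -- the row entries towards `i`
  have h1 : x (u, i) = x (v, i) := by
    have := congrFun h ⟨i, by omega⟩
    simp only [rawSig, Fin.is_lt, dif_pos, Fin.eta, hi, if_false] at this
    exact this
  -- the column entries from `i`
  have h2 : x (i, u) = x (i, v) := by
    have := congrFun h ⟨m + i, by omega⟩
    have hlt : ¬ (m + (i : ℕ) < m) := by omega
    have heq : (⟨m + (i : ℕ) - m, by omega⟩ : Fin m) = i := Fin.ext (by simp)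
    simp only [rawSig, hlt, dif_neg, not_false_eq_true, heq, hi, if_false] at this
    exact this
  simp only [SimpleGraph.fromRel_adj, ne_eq, hiu, not_false_eq_true, true_and, hiv, h1, h2]

/-- The readout hypothesis for any colouring of `W` refining the raw-signature ranks `k ↦ #{v ∈ W | rawSig v <lex rawSig k}` (the
`rankIn` colouring of the root module) — e.g. its refinement `refineIn (rootGraph x) W _`. [folklore] -/
theorem hsig_of_refines_rawSigRank {col : Fin m → ℕ}
    (hcol : ∀ u ∈ W, ∀ v ∈ W, col u = col v →
      keyRank W (fun k => toLex (rawSig W x k)) u = keyRank W (fun k => toLex (rawSig W x k)) v) :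
    ∀ u ∈ W, ∀ v ∈ W, col u = col v → ∀ i, i ∉ W → ((rootGraph x).Adj i u ↔ (rootGraph x).Adj i v) :=
  fun _ hu _ hv h i hi => rootGraph_adj_iff_of_rawSig_eq hu hv
    (toLex.injective (key_eq_of_keyRank_eq (f := fun k => toLex (rawSig W x k)) hu hv (hcol _ hu _ hv h))) i hi

/-- The `rankIn` colouring of a `VecCmp` gadget on the signature wires IS the raw-signature rank. [folklore] -/
theorem vecCmp_rankIn_eq_keyRank {Λ : Type*} [DecidableEq Λ] {P : SymProg (Fin m × Fin m) Λ} (C : P.VecCmp (Fin m) (m + m)) {ff : Λ}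
    (hff : P.sem x ff = false) (hb : ∀ u j, C.b u j = sigWire W (Sum.inr ff) u j) (u : Fin m) :
    C.rankIn x W u = keyRank W (fun k => toLex (rawSig W x k)) u := by
  unfold VecCmp.rankIn keyRank
  simp only [vecCmp_B_eq_rawSig C hff hb]

/-- **`hsig` for the root colouring of the compiler**: the refinement inside `W` of the `rankIn` colouring of a `VecCmp` gadget on the
signature wires satisfies the readout hypothesis. [folklore] -/
theorem hsig_refineIn_rankIn {Λ : Type*} [DecidableEq Λ] {P : SymProg (Fin m × Fin m) Λ} (C : P.VecCmp (Fin m) (m + m)) {ff : Λ}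
    (hff : P.sem x ff = false) (hb : ∀ u j, C.b u j = sigWire W (Sum.inr ff) u j) :
    ∀ u ∈ W, ∀ v ∈ W, BranchSum.refineIn (rootGraph x) W (C.rankIn x W) u = BranchSum.refineIn (rootGraph x) W (C.rankIn x W) v →
      ∀ i, i ∉ W → ((rootGraph x).Adj i u ↔ (rootGraph x).Adj i v) := by
  refine hsig_of_refines_rawSigRank fun u hu v hv h => ?_
  rw [← vecCmp_rankIn_eq_keyRank C hff hb, ← vecCmp_rankIn_eq_keyRank C hff hb]
  exact BranchSum.refineIn_refines _ hu hv h

/-- Raw-signature ranks of window vertices are `< |W|`. [folklore] -/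
theorem vecCmp_rankIn_lt_card {Λ : Type*} [DecidableEq Λ] {P : SymProg (Fin m × Fin m) Λ} (C : P.VecCmp (Fin m) (m + m)) {u : Fin m}
    (hu : u ∈ W) : C.rankIn x W u < W.card := by
  unfold VecCmp.rankIn
  exact card_lt_card ((filter_ssubset).2 ⟨u, hu, lt_irrefl _⟩)

end RawSig

/-! ### The bit readout -/

section OutB

variable {m n : ℕ} (W : Finset (Fin m)) (hn : W.card ≤ n) (G : SimpleGraph (Fin m)) [DecidableRel G.Adj] (colw : Fin m → ℕ) (E : BVal n)

/-- The ROW of a window vertex inside `Fin n`: its rank among the window indices. [folklore] -/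
def wrow (u : Fin m) (hu : u ∈ W) : Fin n := Fin.castLE hn (wpos W rfl u hu)

/-- **The OUTPUT MATRIX read off the bits of the root value `E`**, the colour tests `[colw u = c]` and the input adjacency (see the module
docstring). [folklore] -/
def outB (q : Fin m × Fin m) : Bool :=
  if hi : q.1 ∈ W then
    if hj : q.2 ∈ W then E (aIdx (wrow W hn q.1 hi) (wrow W hn q.2 hj))
    else decide (∃ c : Fin n, E (cIdx (wrow W hn q.1 hi) c) = true ∧ ∃ u ∈ W, colw u = c ∧ G.Adj q.2 u)
  else
    if hj : q.2 ∈ W then decide (∃ c : Fin n, E (cIdx (wrow W hn q.2 hj) c) = true ∧ ∃ u ∈ W, colw u = c ∧ G.Adj q.1 u)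
    else decide (G.Adj q.1 q.2)

/-- **What the root value must satisfy** for the readout, abstractly: its first `|W|` rows are distinct window vertices `l k`, the colour
bit `(k, c)` reads `[colw (l k) = c]`, the adjacency bit `(k, k')` reads `[l k ~ l k']`, and window colours are `< n`. [folklore] -/
structure RowData (l : Fin n → Fin m) : Prop where
  /-- rows are window vertices -/
  mem : ∀ k : Fin n, (k : ℕ) < W.card → l k ∈ W
  /-- rows are distinct -/
  inj : ∀ k k' : Fin n, (k : ℕ) < W.card → (k' : ℕ) < W.card → l k = l k' → k = k'
  /-- colour bits -/
  cbit : ∀ k c : Fin n, (k : ℕ) < W.card → (E (cIdx k c) = true ↔ colw (l k) = c)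
  /-- adjacency bits -/
  abit : ∀ k k' : Fin n, (k : ℕ) < W.card → (k' : ℕ) < W.card → (E (aIdx k k') = true ↔ G.Adj (l k) (l k'))
  /-- window colours are representable -/
  lt : ∀ u ∈ W, colw u < n

variable {W hn G colw E}

/-- The row of a window vertex is below `|W|`. [folklore] -/
theorem wrow_lt (u : Fin m) (hu : u ∈ W) : ((wrow W hn u hu : Fin n) : ℕ) < W.card := by
  show ((wpos W rfl u hu : Fin W.card) : ℕ) < W.card
  exact Fin.is_lt _

/-- The row of a window vertex, as a number, is its rank `wpos`. [folklore] -/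
theorem val_wrow (u : Fin m) (hu : u ∈ W) : ((wrow W hn u hu : Fin n) : ℕ) = (wpos W rfl u hu : ℕ) := rfl

/-- **The bit readout is the colour/bit readout `outM`** of the rows: `rc k = colw (l k)`, `rb k k' = [l k ~ l k']`. [folklore] -/
theorem outB_eq_outM {l : Fin n → Fin m} (hR : RowData W G colw E l) (q : Fin m × Fin m) :
    outB W hn G colw E q =
      outM W rfl G colw (fun k => colw (l (Fin.castLE hn k))) (fun k k' => decide (G.Adj (l (Fin.castLE hn k)) (l (Fin.castLE hn k')))) q := by
  obtain ⟨i, j⟩ := q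
  -- the mixed entry: a colour bit of row `wrow i` and a window vertex of that colour
  have hmixed : ∀ (i o : Fin m) (hi : i ∈ W),
      (∃ c : Fin n, E (cIdx (wrow W hn i hi) c) = true ∧ ∃ u ∈ W, colw u = c ∧ G.Adj o u) ↔
        ∃ u ∈ W, colw u = colw (l (Fin.castLE hn (wpos W rfl i hi))) ∧ G.Adj o u := by
    intro i o hi
    have hrow : Fin.castLE hn (wpos W rfl i hi) = wrow W hn i hi := rfl
    rw [hrow]
    constructor
    · rintro ⟨c, hc, u, hu, hcu, hadj⟩
      rw [hR.cbit _ _ (wrow_lt i hi)] at hc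
      exact ⟨u, hu, hcu.trans hc.symm, hadj⟩
    · rintro ⟨u, hu, hcu, hadj⟩
      have hlt : colw (l (wrow W hn i hi)) < n := hR.lt _ (hR.mem _ (wrow_lt i hi))
      refine ⟨⟨_, hlt⟩, ?_, u, hu, hcu, hadj⟩
      rw [hR.cbit _ _ (wrow_lt i hi)]
  by_cases hi : i ∈ W <;> by_cases hj : j ∈ W
  · simp only [outB, outM, hi, hj, dif_pos]
    rw [Bool.eq_iff_iff, hR.abit _ _ (wrow_lt i hi) (wrow_lt j hj), decide_eq_true_iff]
    rfl
  · simp only [outB, outM, hi, hj, dif_pos, dif_neg, not_false_eq_true]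
    rw [decide_eq_decide]
    exact hmixed i j hi
  · simp only [outB, outM, hi, hj, dif_pos, dif_neg, not_false_eq_true]
    rw [decide_eq_decide]
    exact hmixed j i hj
  · simp only [outB, outM, hi, hj, dif_neg, not_false_eq_true]

/-- **Soundness of the bit readout.** If `colw` satisfies the readout hypothesis on `W` (equal colour ⇒ equal adjacency to the ordered
part) and `E` has row data `l`, the graph of `outB` is the graph of `G` relabelled by a permutation fixing every index outside `W`. [folklore] -/
theorem outB_sound (hsig : ∀ u ∈ W, ∀ v ∈ W, colw u = colw v → ∀ i, i ∉ W → (G.Adj i u ↔ G.Adj i v)) {l : Fin n → Fin m}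
    (hR : RowData W G colw E l) :
    ∃ ρ : Equiv.Perm (Fin m), (∀ i, i ∉ W → ρ i = i) ∧
      (SimpleGraph.fromRel fun u v => outB W hn G colw E (u, v) = true) = SimpleGraph.fromRel fun u v => G.Adj (ρ u) (ρ v) := by
  have hlinj : Function.Injective fun k : Fin W.card => l (Fin.castLE hn k) := by
    intro k k' h
    have := hR.inj _ _ (by exact k.is_lt) (by exact k'.is_lt) h
    exact Fin.castLE_injective hn this
  obtain ⟨ρ, hρO, -, hgr⟩ := outM_sound (W := W) (hg := rfl) (G := G) (col₀ := colw) (rc := fun k => colw (l (Fin.castLE hn k)))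
    (rb := fun k k' => decide (G.Adj (l (Fin.castLE hn k)) (l (Fin.castLE hn k')))) hsig _ hlinj (fun k => hR.mem _ k.is_lt)
    (fun _ => rfl) (fun _ _ => rfl)
  refine ⟨ρ, hρO, ?_⟩
  rw [← hgr]
  congr 1
  funext u v
  rw [outB_eq_outM hR]

/-- **Soundness of the bit readout, matrix form** (`GraphProgram.sound`): for the graph `rootGraph x` of an input matrix and the window
`windowSet m`, the graph of `outB` is the graph of a `Bud(m,⌊log₂ m⌋)`-relabelling of the input. [folklore] -/
theorem outB_sound_matrix (hW : W = windowSet m) (x : Fin m × Fin m → Bool) {colw : Fin m → ℕ} {E : BVal n}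
    (hsig : ∀ u ∈ W, ∀ v ∈ W, colw u = colw v → ∀ i, i ∉ W → ((rootGraph x).Adj i u ↔ (rootGraph x).Adj i v))
    {l : Fin n → Fin m} (hR : RowData W (rootGraph x) colw E l) :
    ∃ ρ ∈ pointStabiliserBudget m (Nat.log 2 m),
      (SimpleGraph.fromRel fun u v => outB W hn (rootGraph x) colw E (u, v) = true) =
        SimpleGraph.fromRel fun u v => x (ρ u, ρ v) = true := by
  obtain ⟨ρ, hρO, hgr⟩ := outB_sound (hn := hn) hsig hR
  refine ⟨ρ, mem_budget_of_fix fun i hi => hρO i (hW ▸ hi), ?_⟩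
  rw [hgr]
  ext a b
  simp only [SimpleGraph.fromRel_adj, ne_eq, EmbeddingLike.apply_eq_iff_eq]
  tauto

/-! ### Row data from the two shapes of the root theorem -/

/-- **Process on `Fin m`, start block `W`**: the encoding `bitEnc G n colw |W| e` along an enumeration `e` of `W` (`IsEnum n W e`), with
window colours `< n`, has row data `e`. [folklore] -/
theorem rowData_of_isEnum {e : Fin n → Fin m} (he : IsEnum n W e) (hlt : ∀ u ∈ W, colw u < n) :
    RowData W G colw (bitEnc G n colw W.card e) e where
  mem := he.mem
  inj := he.inj
  cbit k c hk := by rw [bitEnc_cIdx, decide_eq_true_iff]; exact ⟨fun h => h.2, fun h => ⟨hk, h⟩⟩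
  abit k k' hk hk' := by rw [bitEnc_aIdx, decide_eq_true_iff]; exact ⟨fun h => h.2.2, fun h => ⟨hk, hk', h⟩⟩
  lt := hlt

/-- Extending a colouring of the window type `↥W` by `0` to all indices. [folklore] -/
def extendCol (W : Finset (Fin m)) (cw : ↥W → ℕ) (i : Fin m) : ℕ := if h : i ∈ W then cw ⟨i, h⟩ else 0

/-- The extension agrees with `cw` on the window. [folklore] -/
@[simp] theorem extendCol_apply (cw : ↥W → ℕ) (u : ↥W) : extendCol W cw u = cw u := by
  obtain ⟨u, hu⟩ := u
  simp [extendCol, hu]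

/-- **Process on the window TYPE `↥W`** (graph `G.comap Subtype.val`, start block `univ`): the encoding along an enumeration `e` of `univ`
(`IsEnum n univ e`), with colours `< n`, has row data `Subtype.val ∘ e` for the extended colouring. [folklore] -/
theorem rowData_of_isEnum_subtype {cw : ↥W → ℕ} {e : Fin n → ↥W} (he : IsEnum n (univ : Finset ↥W) e) (hlt : ∀ u, cw u < n) :
    RowData W G (extendCol W cw) (bitEnc (G.comap Subtype.val) n cw (univ : Finset ↥W).card e) (fun k => (e k : Fin m)) where
  mem k _ := (e k).2
  inj k k' hk hk' h := by
    have hc : (univ : Finset ↥W).card = W.card := by rw [card_univ, Fintype.card_coe]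
    exact he.inj k k' (hc ▸ hk) (hc ▸ hk') (Subtype.val_injective h)
  cbit k c hk := by
    have hc : (univ : Finset ↥W).card = W.card := by rw [card_univ, Fintype.card_coe]
    rw [bitEnc_cIdx, decide_eq_true_iff, extendCol_apply, hc]
    exact ⟨fun h => h.2, fun h => ⟨hk, h⟩⟩
  abit k k' hk hk' := by
    have hc : (univ : Finset ↥W).card = W.card := by rw [card_univ, Fintype.card_coe]
    rw [bitEnc_aIdx, decide_eq_true_iff, SimpleGraph.comap_adj, hc]
    exact ⟨fun h => h.2.2, fun h => ⟨hk, hk', h⟩⟩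
  lt u hu := by
    have := hlt ⟨u, hu⟩
    simpa [extendCol, hu] using this

end OutB

end GraphReadout

end Summit.PneNP.PneNP.Theorems
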